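import Mathlib
import HarnessLib
import Summits.Langlands.Langlands.Theses.SkinnerWilesDefectOne
import Summits.Langlands.Langlands.Theorems.SkinnerWilesDefectOneReducibleOrdinaryProModularDefs
import Summits.Langlands.Langlands.Theorems.SkinnerWilesDefectOneReducibleOrdinaryProModularFineSelmerDefs
import Summits.Langlands.Langlands.Theorems.SkinnerWilesDefectOneProModularOfEisensteinSeedProModularPrimes
import Summits.Langlands.Langlands.Theorems.SkinnerWilesDefectOneProModularOfEisensteinSeedPropagationSkeleton
import Literature.NumberTheory.GaloisRepresentations.NearlyOrdinaryDeformationRing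

/-!
# Stub (P1) `stub_descentFromPatchingPrime`: the minimal-prime reduction, the identity point, and the
# conditional form

Route `SkinnerWilesDefectOne`, crux `ReducibleOrdinaryProModular` (stmt-Langlands-12919), line
`fine-selmer-codimension-two` (lead skeleton v3, `Cruxes/ReducibleOrdinaryProModular/Lines/
fine_selmer_codimension_two.lean`), registered stub `stub_descentFromPatchingPrime` = Skinner–Wiles'
property **(P1)** ([SW, §4.2, p. 63]: "if `𝔭 ⊆ 𝕋_𝒟` is any prime that is nice for `𝒟`, then any prime
`Q ⊆ 𝔭^R ⊆ R_𝒟` is pro-modular") at Taylor–Wiles defect `l₀ = 1` (`F` imaginary quadratic): below a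
pro-modular PATCHING prime `𝔭` of `R_𝒟` (`IsPatchingPrime`: `dim R/𝔭 = 1`, `ρ_𝒟 mod 𝔭` irreducible,
nearly-ordinary ratios of infinite order at `v ∣ p`) every prime is pro-modular at some tame level.
(P1) is the defect-one patching theorem; it is OPEN (no theorem in print proves it over an imaginary
quadratic field) and this file does NOT prove it.  It lands what IS provable around it:

* §1 (abstract; any commutative ring `R`, any predicate `ProMod` on `Spec R` that ASCENDS along
  specialisation): `proMod_of_le_of_forall_minimalPrimes_le` — if every MINIMAL prime below `𝔭` satisfies
  `ProMod` then so does every prime below `𝔭` (every prime lies above a minimal one,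
  `primeSpectrum_exists_minimalPrimes_le`, then ascend); hence (P1)-shaped statements are EQUIVALENT to
  their minimal-prime forms (`forall_le_iff_forall_minimalPrimes_le`, `descent_iff_descent_minimalPrimes`,
  `forall_iff_forall_minimalPrimes`).  This is the book-keeping of [SW, §4.3, proof of Prop. 4.1, step
  one]: "It follows from (P1) that if `Q ⊆ 𝔭` is any prime of `R_𝒟` then `Q` is pro-modular.  In
  particular, any minimal prime of `R_𝒟` contained in `𝔭` is pro-modular."
* §2 (the crux's vocabulary `IsProModularPrimeAt` / `IsProModularPrime` / `ModelData`):
  `stub_descentFromPatchingPrime_auxMinimal` (registered sub-goal) — (P1) for `M` at `𝔭` follows from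
  "every minimal prime of `R_𝒟` below `𝔭` (= every irreducible component through `𝔭` = every minimal
  prime of the local ring `(R_𝒟)_𝔭`) is pro-modular", which is exactly the OUTPUT SHAPE of a patching
  argument localised at `𝔭`; `descentFromPatchingPrime_iff_minimal` — the registered statement of (P1),
  verbatim, is equivalent to that minimal-prime form; and the IDENTITY-POINT lemma
  `isProModularPrimeAt_of_ringPoint`: a continuous point `x : 𝕋(𝒰) → R_𝒟` (for the `𝔪_R`-adic topology)
  with which `ρ_𝒟` ITSELF is associated off `𝒰.bad` makes every prime of `R_𝒟` pro-modular at `𝒰`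
  (compose with `R_𝒟 → R_𝒟/𝔮`) — the form in which an Eisenstein "`R → 𝕋 → R`" statement enters.
* §3 the honest conditional: `OrientedFamiliesProModular` — "for every SW-oriented model over an
  imaginary quadratic field, `p` odd, every prime of `R_𝒟` is pro-modular at ONE tame level" — is the
  (P1)-sector of the Eisenstein big-`R = 𝕋` expectation for the completed cohomology of the Bianchi tower
  (`(R^ps_S)^red ≅ (𝕋(𝒰)_𝔪)^red` at the Eisenstein maximal ideal `𝔪` of `χ̄₁ ⊕ χ̄₂`, level deep enough
  at `S ∖ {v ∣ p}`; [GeeNewton2020, §3.3], [CalegariEmerton2011, §2]; Galois side modulo nilpotents: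
  [Scholze2015, Cor. V.4.3–V.4.4] for `F` CM).  It is a `def … : Prop`, NOT asserted, consumed only as a
  hypothesis (as `ProModularityGL2` in the crux's Disproof file).  `stub_descentFromPatchingPrime_auxOfBigRT`
  (registered sub-goal: components pro-modular at a common level ⟹ (P1) for `M`) and
  `descentFromPatchingPrime_of_orientedFamiliesProModular` ((P1) VERBATIM from the expectation) record
  that (P1) is a formal consequence of it; `forall_isProModularPrime_of_orientedFamiliesProModular`
  records that so is the whole conclusion of [SW, Prop. 4.1] for these models.

What is deliberately NOT here: any patching; the pseudo-deformation ring `R^ps_S` (no Chenevier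
determinants in the tree); level-uniformisation "pro-modular at some level for every `𝔮` ⟹ at one
level" (needs local–global compatibility at `S ∖ p`).

References: C. M. Skinner, A. J. Wiles, *Residually reducible representations and modular forms*, Publ.
Math. IHÉS 89 (1999) 5–126, §4.1 (p. 62), §4.2 ((P1), p. 63), §4.3 (proof of Prop. 4.1, p. 64)
[SkinnerWiles1999]; T. Gee, J. Newton, *Patching and the completed homology of locally symmetric
spaces*, JIMJ 21 (2022), §3.3 [GeeNewton2020]; F. Calegari, M. Emerton, *Completed cohomology — a
survey* (2011), §2 [CalegariEmerton2011]; P. Scholze, Ann. of Math. 182 (2015), Cor. V.4.3–V.4.4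
[Scholze2015].
-/

set_option linter.dupNamespace false -- project-wide option (lakefile weak.linter.dupNamespace); `Summit.Langlands.Langlands` is the mandated namespace

/-! ## 1. Descent to a down-set from its minimal primes (abstract order theory on `Spec R`) -/

namespace Summit.Langlands.Langlands.Theorems

variable {R : Type*} [CommRing R]

/-- **Descent from the minimal primes below `𝔭`.**  If `ProMod` ascends along specialisation
(`𝔮 ≤ 𝔭 → ProMod 𝔮 → ProMod 𝔭`) and holds at every MINIMAL prime `C ≤ 𝔭`, then it holds at every
prime `𝔮 ≤ 𝔭`: `𝔮` lies above some minimal prime `C` (`primeSpectrum_exists_minimalPrimes_le`), and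
`C ≤ 𝔮 ≤ 𝔭`.  [SW, §4.3, proof of Prop. 4.1, step one] in abstract form.
[cite: SkinnerWiles1999, §4.3 proof of Prop. 4.1 (step one)] -/
theorem proMod_of_le_of_forall_minimalPrimes_le (ProMod : PrimeSpectrum R → Prop)
    (up : ∀ 𝔮 𝔭 : PrimeSpectrum R, 𝔮 ≤ 𝔭 → ProMod 𝔮 → ProMod 𝔭) {𝔭 : PrimeSpectrum R}
    (h : ∀ C : PrimeSpectrum R, C.asIdeal ∈ minimalPrimes R → C ≤ 𝔭 → ProMod C)
    {𝔮 : PrimeSpectrum R} (h𝔮 : 𝔮 ≤ 𝔭) : ProMod 𝔮 := by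
  obtain ⟨C, hC, hC𝔮⟩ := primeSpectrum_exists_minimalPrimes_le 𝔮
  exact up C 𝔮 hC𝔮 (h C hC (hC𝔮.trans h𝔮))

/-- **"Every prime below `𝔭`" ⟺ "every minimal prime below `𝔭`"** for an ascending predicate.
[folklore] -/
theorem forall_le_iff_forall_minimalPrimes_le (ProMod : PrimeSpectrum R → Prop)
    (up : ∀ 𝔮 𝔭 : PrimeSpectrum R, 𝔮 ≤ 𝔭 → ProMod 𝔮 → ProMod 𝔭) (𝔭 : PrimeSpectrum R) :
    (∀ 𝔮 : PrimeSpectrum R, 𝔮 ≤ 𝔭 → ProMod 𝔮) ↔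
      ∀ C : PrimeSpectrum R, C.asIdeal ∈ minimalPrimes R → C ≤ 𝔭 → ProMod C :=
  ⟨fun h C _ hC => h C hC, fun h _ h𝔮 => proMod_of_le_of_forall_minimalPrimes_le ProMod up h h𝔮⟩

/-- **"Every prime" ⟺ "every minimal prime"** for an ascending predicate on `Spec R` (the form in
which [SW, Prop. 4.1] "every prime of `R_𝒟` is pro-modular" is proved: all components are
pro-modular). [cite: SkinnerWiles1999, §4.1 p. 62] -/
theorem forall_iff_forall_minimalPrimes (ProMod : PrimeSpectrum R → Prop)
    (up : ∀ 𝔮 𝔭 : PrimeSpectrum R, 𝔮 ≤ 𝔭 → ProMod 𝔮 → ProMod 𝔭) :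
    (∀ 𝔮 : PrimeSpectrum R, ProMod 𝔮) ↔
      ∀ C : PrimeSpectrum R, C.asIdeal ∈ minimalPrimes R → ProMod C := by
  refine ⟨fun h C _ => h C, fun h 𝔮 => ?_⟩
  obtain ⟨C, hC, hC𝔮⟩ := primeSpectrum_exists_minimalPrimes_le 𝔮
  exact up C 𝔮 hC𝔮 (h C hC)

/-- **(P1) ⟺ its minimal-prime form**, abstractly: for an ascending `ProMod` and any `Nice`,
"below every nice `ProMod` prime every prime is `ProMod`" iff "below every nice `ProMod` prime every
MINIMAL prime is `ProMod`". [cite: SkinnerWiles1999, §4.2 (P1) and §4.3] -/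
theorem descent_iff_descent_minimalPrimes (ProMod Nice : PrimeSpectrum R → Prop)
    (up : ∀ 𝔮 𝔭 : PrimeSpectrum R, 𝔮 ≤ 𝔭 → ProMod 𝔮 → ProMod 𝔭) :
    (∀ 𝔭 : PrimeSpectrum R, Nice 𝔭 → ProMod 𝔭 → ∀ 𝔮 : PrimeSpectrum R, 𝔮 ≤ 𝔭 → ProMod 𝔮) ↔
      ∀ 𝔭 : PrimeSpectrum R, Nice 𝔭 → ProMod 𝔭 →
        ∀ C : PrimeSpectrum R, C.asIdeal ∈ minimalPrimes R → C ≤ 𝔭 → ProMod C :=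
  forall_congr' fun 𝔭 => forall_congr' fun _ => forall_congr' fun _ =>
    forall_le_iff_forall_minimalPrimes_le ProMod up 𝔭

end Summit.Langlands.Langlands.Theorems

/-! ## 2. In the crux's vocabulary: pro-modular primes of `R_𝒟` -/

namespace Summit.Langlands.Langlands.Cruxes.ReducibleOrdinaryProModular.FineSelmerCodimensionTwo

open scoped NumberField MatrixGroups
open Filter NumberField IsDedekindDomain Field Matrix IsLocalRing
open Literature.NumberTheory.Automorphic Literature.NumberTheory.Automorphic.BigHeckeGLn
open Literature.NumberTheory.GaloisRepresentations
open Summit.Langlands.Langlands.Theses.SkinnerWilesDefectOne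
open Summit.Langlands.Langlands.Cruxes.ReducibleOrdinaryProModular.SteinbergHyperplane

noncomputable section

variable {F : Type} [Field F] [NumberField F] {p : ℕ} [Fact p.Prime]
variable {𝒪 : Type} [CommRing 𝒪] {k : Type} [Field k] [Algebra 𝒪 k] {𝒟 : NearlyOrdinaryDatum F p 𝒪 k}
variable (𝓡 : NearlyOrdinaryDeformationRing.{0} 𝒟)

/-- **Pro-modularity (at some level) below `𝔭` from the minimal primes below `𝔭`.**  If every
minimal prime `C ⊆ 𝔭` of `R_𝒟` is pro-modular at some tame level, so is every prime `𝔮 ⊆ 𝔭`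
(going up, `IsProModularPrime.of_le`, from a minimal prime below `𝔮`).
[cite: SkinnerWiles1999, §4.3 proof of Prop. 4.1 (step one)] -/
theorem isProModularPrime_of_le_of_forall_minimalPrimes_le {𝔭 : PrimeSpectrum 𝓡.R}
    (h : ∀ C : PrimeSpectrum 𝓡.R, C.asIdeal ∈ minimalPrimes 𝓡.R → C ≤ 𝔭 → IsProModularPrime 𝓡 C)
    {𝔮 : PrimeSpectrum 𝓡.R} (h𝔮 : 𝔮 ≤ 𝔭) : IsProModularPrime 𝓡 𝔮 :=
  Summit.Langlands.Langlands.Theorems.proMod_of_le_of_forall_minimalPrimes_le (IsProModularPrime 𝓡)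
    (fun _ _ hle h' => IsProModularPrime.of_le 𝓡 hle h') h h𝔮

/-- The same at a FIXED tame level `𝒰` (going up at fixed level, `IsProModularPrimeAt.of_le`).
[cite: SkinnerWiles1999, §4.3 proof of Prop. 4.1 (step one)] -/
theorem isProModularPrimeAt_of_le_of_forall_minimalPrimes_le {𝒰 : TameLevel 2 F p}
    {𝔭 : PrimeSpectrum 𝓡.R}
    (h : ∀ C : PrimeSpectrum 𝓡.R, C.asIdeal ∈ minimalPrimes 𝓡.R → C ≤ 𝔭 →
      IsProModularPrimeAt 𝓡 𝒰 C)
    {𝔮 : PrimeSpectrum 𝓡.R} (h𝔮 : 𝔮 ≤ 𝔭) : IsProModularPrimeAt 𝓡 𝒰 𝔮 :=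
  Summit.Langlands.Langlands.Theorems.proMod_of_le_of_forall_minimalPrimes_le (IsProModularPrimeAt 𝓡 𝒰)
    (fun _ _ hle h' => IsProModularPrimeAt.of_le 𝓡 hle h') h h𝔮

/-- **Every prime of `R_𝒟` is pro-modular at `𝒰` iff every minimal prime is** ("the components are
pro-modular", [SW, §4.1 p. 62]). [cite: SkinnerWiles1999, §4.1 p. 62] -/
theorem forall_isProModularPrimeAt_iff_minimalPrimes (𝒰 : TameLevel 2 F p) :
    (∀ 𝔮 : PrimeSpectrum 𝓡.R, IsProModularPrimeAt 𝓡 𝒰 𝔮) ↔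
      ∀ C : PrimeSpectrum 𝓡.R, C.asIdeal ∈ minimalPrimes 𝓡.R → IsProModularPrimeAt 𝓡 𝒰 C :=
  Summit.Langlands.Langlands.Theorems.forall_iff_forall_minimalPrimes _
    (fun _ _ hle h => IsProModularPrimeAt.of_le 𝓡 hle h)

/-- **Every prime of `R_𝒟` is pro-modular at some level iff every minimal prime is.**
[cite: SkinnerWiles1999, §4.1 p. 62] -/
theorem forall_isProModularPrime_iff_minimalPrimes :
    (∀ 𝔮 : PrimeSpectrum 𝓡.R, IsProModularPrime 𝓡 𝔮) ↔
      ∀ C : PrimeSpectrum 𝓡.R, C.asIdeal ∈ minimalPrimes 𝓡.R → IsProModularPrime 𝓡 C :=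
  Summit.Langlands.Langlands.Theorems.forall_iff_forall_minimalPrimes _
    (fun _ _ hle h => IsProModularPrime.of_le 𝓡 hle h)

/-- **Registered sub-goal `stub_descentFromPatchingPrime_auxMinimal` — (P1) reduces to the minimal
primes below the patching prime.**  For any model `M` and any prime `𝔭` of `R_𝒟`: if every minimal
prime `C ⊆ 𝔭` (every irreducible component of `Spec R_𝒟` through `𝔭`, i.e. every minimal prime of the
local ring `(R_𝒟)_𝔭` at which a patching argument is run) is pro-modular at some tame level, then every
prime `𝔮 ⊆ 𝔭` is.  So the content of (P1) is exactly "the components through a pro-modular patching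
prime are pro-modular" ([SW, §4.3]: "any component of `spec(R_𝒟)` containing a nice prime is itself
pro-modular"). [cite: SkinnerWiles1999, §4.3 proof of Prop. 4.1 (step one)] -/
theorem stub_descentFromPatchingPrime_auxMinimal :
    ∀ (F : Type) [Field F] [NumberField F] (p : ℕ) [Fact p.Prime] (M : ModelData F p)
      (𝔭 : PrimeSpectrum M.𝓡.R),
      (∀ C : PrimeSpectrum M.𝓡.R, C.asIdeal ∈ minimalPrimes M.𝓡.R → C ≤ 𝔭 →
          IsProModularPrime M.𝓡 C) →
        ∀ 𝔮 : PrimeSpectrum M.𝓡.R, 𝔮 ≤ 𝔭 → IsProModularPrime M.𝓡 𝔮 :=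
  fun _ _ _ _ _ M _ h _ h𝔮 => isProModularPrime_of_le_of_forall_minimalPrimes_le M.𝓡 h h𝔮

/-- **(P1), verbatim as registered, is equivalent to its minimal-prime form** (the two statements
differ only in the last two binders; `descent_iff_descent_minimalPrimes` with going up).
[cite: SkinnerWiles1999, §4.2 (P1) and §4.3] -/
theorem descentFromPatchingPrime_iff_minimal :
    (∀ (F : Type) [Field F] [NumberField F], IsTotallyComplex F → Module.finrank ℚ F = 2 →
      ∀ (p : ℕ) [Fact p.Prime], p ≠ 2 →
      ∀ M : ModelData F p, M.IsSWOriented p →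
        ∀ 𝔭 : PrimeSpectrum M.𝓡.R, IsPatchingPrime M.𝓡 𝔭 → IsProModularPrime M.𝓡 𝔭 →
          ∀ 𝔮 : PrimeSpectrum M.𝓡.R, 𝔮 ≤ 𝔭 → IsProModularPrime M.𝓡 𝔮) ↔
    (∀ (F : Type) [Field F] [NumberField F], IsTotallyComplex F → Module.finrank ℚ F = 2 →
      ∀ (p : ℕ) [Fact p.Prime], p ≠ 2 →
      ∀ M : ModelData F p, M.IsSWOriented p →
        ∀ 𝔭 : PrimeSpectrum M.𝓡.R, IsPatchingPrime M.𝓡 𝔭 → IsProModularPrime M.𝓡 𝔭 →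
          ∀ C : PrimeSpectrum M.𝓡.R, C.asIdeal ∈ minimalPrimes M.𝓡.R → C ≤ 𝔭 →
            IsProModularPrime M.𝓡 C) := by
  refine forall_congr' fun F => forall_congr' fun _ => forall_congr' fun _ => forall_congr' fun _ =>
    forall_congr' fun _ => forall_congr' fun p => forall_congr' fun _ => forall_congr' fun _ =>
    forall_congr' fun M => forall_congr' fun _ => forall_congr' fun 𝔭 => forall_congr' fun _ =>
    forall_congr' fun _ => ?_
  exact Summit.Langlands.Langlands.Theorems.forall_le_iff_forall_minimalPrimes_le _
    (fun _ _ hle h => IsProModularPrime.of_le M.𝓡 hle h) 𝔭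

/-! ### The identity point: `ρ_𝒟` itself associated with a continuous point of `𝕋(𝒰)` -/

/-- The canonical surjection `R → R/𝔮` is continuous for the `𝔪`-adic topologies (`𝔪` any ideal,
pushed forward to the quotient; Mathlib `WithIdeal.uniformContinuous_of_map_le`). [folklore] -/
theorem continuous_mk_adic {A : Type*} [CommRing A] (𝔪 𝔮 : Ideal A) :
    @Continuous A (A ⧸ 𝔮) 𝔪.adicTopology (𝔪.map (Ideal.Quotient.mk 𝔮)).adicTopology
      (Ideal.Quotient.mk 𝔮) := by
  letI : WithIdeal A := ⟨𝔪⟩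
  letI : WithIdeal (A ⧸ 𝔮) := ⟨𝔪.map (Ideal.Quotient.mk 𝔮)⟩
  exact (WithIdeal.uniformContinuous_of_map_le (f := Ideal.Quotient.mk 𝔮) le_rfl).continuous

omit [Fact p.Prime] in
/-- `ρ_𝒟 mod 𝔮` is unramified wherever `ρ_𝒟` is. [folklore] -/
theorem isUnramifiedAt_modPrime {v : HeightOneSpectrum (𝓞 F)}
    (hv : Deformation.IsUnramifiedAt v 𝓡.ρ) (𝔮 : PrimeSpectrum 𝓡.R) :
    Deformation.IsUnramifiedAt v (𝓡.modPrime 𝔮) := by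
  intro 𝔓 h𝔓 σ hσ
  rw [NearlyOrdinaryDeformationRing.modPrime, MonoidHom.comp_apply, hv 𝔓 h𝔓 σ hσ, map_one]

omit [Fact p.Prime] in
/-- The characteristic polynomial of `(ρ_𝒟 mod 𝔮)(σ)` is the reduction of that of `ρ_𝒟(σ)`.
[folklore] -/
theorem charpoly_modPrime (𝔮 : PrimeSpectrum 𝓡.R) (σ : absoluteGaloisGroup F) :
    (𝓡.modPrime 𝔮 σ).val.charpoly =
      ((𝓡.ρ σ).val.charpoly).map (Ideal.Quotient.mk 𝔮.asIdeal) := by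
  rw [NearlyOrdinaryDeformationRing.modPrime, MonoidHom.comp_apply, ← Matrix.charpoly_map]
  rfl

/-- **The identity point makes every prime pro-modular.**  If `ρ_𝒟 : Γ_F → GL₂(R_𝒟)` ITSELF is
associated, off `𝒰.bad`, with a point `x : 𝕋(𝒰) → R_𝒟` continuous for the `𝔪_R`-adic topology
(unramified at `v ∉ 𝒰.bad` and `charpoly ρ_𝒟(Frob_v) = heckeFrobPoly 2 q_v (x ∘ T_{v,·})`), then EVERY
prime `𝔮` of `R_𝒟` is pro-modular at `𝒰`, with the point `(R_𝒟 → R_𝒟/𝔮) ∘ x`.  This is how an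
Eisenstein "`𝕋(𝒰)_𝔪 → R_𝒟`" map (big `R = 𝕋` composed with `R^ps_S → R_𝒟`) would discharge (P1)
and the whole of [SW, Prop. 4.1] at once. [cite: SkinnerWiles1999, §4.1 p. 62] -/
theorem isProModularPrimeAt_of_ringPoint (𝒰 : TameLevel 2 F p)
    (x : CompletedCohomologyHeckeAlgebraGLn 𝒰 →+* 𝓡.R)
    (hx : @Continuous _ _ inferInstance (maximalIdeal 𝓡.R).adicTopology x)
    (hass : ∀ v ∉ 𝒰.bad, Deformation.IsUnramifiedAt v 𝓡.ρ ∧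
      ∀ 𝔓 ∈ v.primesAbove, ∀ σ : absoluteGaloisGroup F, IsArithFrobAt (𝓞 F) σ 𝔓 →
        (𝓡.ρ σ).val.charpoly =
          heckeFrobPoly 2 (Ideal.absNorm v.asIdeal) (fun i => x (𝒰.heckeT v i)))
    (𝔮 : PrimeSpectrum 𝓡.R) : IsProModularPrimeAt 𝓡 𝒰 𝔮 := by
  refine ⟨(Ideal.Quotient.mk 𝔮.asIdeal).comp x, ?_, fun v hv => ?_⟩
  · exact @Continuous.comp _ _ _ _ (maximalIdeal 𝓡.R).adicTopology
      ((maximalIdeal 𝓡.R).map (Ideal.Quotient.mk 𝔮.asIdeal)).adicTopology _ _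
      (continuous_mk_adic (maximalIdeal 𝓡.R) 𝔮.asIdeal) hx
  · obtain ⟨hunr, hchar⟩ := hass v hv
    refine ⟨isUnramifiedAt_modPrime 𝓡 hunr 𝔮, fun 𝔓 h𝔓 σ hσ => ?_⟩
    rw [charpoly_modPrime 𝓡 𝔮 σ, hchar 𝔓 h𝔓 σ hσ, heckeFrobPoly_map]
    rfl

/-! ## 3. The conditional: (P1) is a formal consequence of Eisenstein pro-modularity of the family -/

/-- **Expectation `OrientedFamiliesProModular` (NOT asserted; an open statement used only as a
hypothesis, like `ProModularityGL2` of the crux's Disproof file).**  For every SW-oriented model `M`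
over an imaginary quadratic `F`, `p` odd, there is ONE tame level `𝒰` at which EVERY prime of the nearly
ordinary deformation ring `R_𝒟` is pro-modular.  This is the (P1)-sector of the Eisenstein
big-`R = 𝕋` conjecture for the completed cohomology of the Bianchi tower: with `𝔪 ⊂ 𝕋(𝒰)` the
Eisenstein maximal ideal of `χ̄₁ ⊕ χ̄₂` (a genuine maximal ideal for `𝒰.bad = 𝒟.S` and `U_S` deep
enough: the pair occurs in `H⁰` of the Borel–Serre boundary, hence — by the boundary sequence and
Lefschetz duality — in `H^•(X_U, k)`), the surjection `R^ps_S ↠ 𝕋(𝒰)_𝔪/J` (`J` nilpotent; Scholze's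
determinants, `F` CM) is expected to have NILPOTENT kernel ([GeeNewton2020, §3.3] big `R = 𝕋`;
[CalegariEmerton2011, §2]); then `𝕋(𝒰) → 𝕋(𝒰)_𝔪/J ≅ R^ps_S/I → R^ps_S/𝔮' ↪ R_𝒟/𝔮` is the required
point for every prime `𝔮` of `R_𝒟` (`𝔮'` its pull-back along the trace map `R^ps_S → R_𝒟`).  The level
is uniform because conductor exponents at `w ∈ S ∖ {v ∣ p}` are bounded along `R_𝒟` (Swan conductor of
a `p`-adic family at `ℓ ≠ p` is that of `ρ̄`, tame part `≤ 2`).  Why it might fail: only with big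
`R = 𝕋` itself; no cheap counterexample is known (a counterexample refutes the completed-cohomology
conjectures for `GL₂` over `F`). -/
def OrientedFamiliesProModular : Prop :=
  ∀ (F : Type) [Field F] [NumberField F], IsTotallyComplex F → Module.finrank ℚ F = 2 →
    ∀ (p : ℕ) [Fact p.Prime], p ≠ 2 →
    ∀ M : ModelData F p, M.IsSWOriented p →
      ∃ 𝒰 : TameLevel 2 F p, ∀ 𝔮 : PrimeSpectrum M.𝓡.R, IsProModularPrimeAt M.𝓡 𝒰 𝔮

/-- **Registered sub-goal `stub_descentFromPatchingPrime_auxOfBigRT` — (P1) for `M` from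
pro-modularity of the components of `Spec R_𝒟` at a common level.**  If at some tame level `𝒰` every
minimal prime of `R_𝒟` is pro-modular (the output of Eisenstein big `R = 𝕋` for the datum, through
`isProModularPrimeAt_of_ringPoint` / `forall_isProModularPrimeAt_iff_minimalPrimes`), then (P1) holds for
`M` at every prime `𝔭` — the patching and pro-modularity hypotheses on `𝔭` are then moot, which is the
honest logical status of (P1) relative to big `R = 𝕋`. [cite: SkinnerWiles1999, §4.2 (P1)] -/
theorem stub_descentFromPatchingPrime_auxOfBigRT :
    ∀ (F : Type) [Field F] [NumberField F] (p : ℕ) [Fact p.Prime] (M : ModelData F p),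
      (∃ 𝒰 : TameLevel 2 F p, ∀ C : PrimeSpectrum M.𝓡.R, C.asIdeal ∈ minimalPrimes M.𝓡.R →
          IsProModularPrimeAt M.𝓡 𝒰 C) →
        ∀ 𝔭 : PrimeSpectrum M.𝓡.R, IsPatchingPrime M.𝓡 𝔭 → IsProModularPrime M.𝓡 𝔭 →
          ∀ 𝔮 : PrimeSpectrum M.𝓡.R, 𝔮 ≤ 𝔭 → IsProModularPrime M.𝓡 𝔮 := by
  intro F _ _ p _ M h 𝔭 _ _ 𝔮 _
  obtain ⟨𝒰, h𝒰⟩ := h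
  exact ⟨𝒰, (forall_isProModularPrimeAt_iff_minimalPrimes M.𝓡 𝒰).mpr h𝒰 𝔮⟩

/-- **(P1), verbatim as registered, follows from `OrientedFamiliesProModular`.**
[cite: SkinnerWiles1999, §4.2 (P1)] -/
theorem descentFromPatchingPrime_of_orientedFamiliesProModular (h : OrientedFamiliesProModular) :
    ∀ (F : Type) [Field F] [NumberField F], IsTotallyComplex F → Module.finrank ℚ F = 2 →
      ∀ (p : ℕ) [Fact p.Prime], p ≠ 2 →
      ∀ M : ModelData F p, M.IsSWOriented p →
        ∀ 𝔭 : PrimeSpectrum M.𝓡.R, IsPatchingPrime M.𝓡 𝔭 → IsProModularPrime M.𝓡 𝔭 →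
          ∀ 𝔮 : PrimeSpectrum M.𝓡.R, 𝔮 ≤ 𝔭 → IsProModularPrime M.𝓡 𝔮 := by
  intro F _ _ hF hdeg p _ hp M hM 𝔭 _ _ 𝔮 _
  obtain ⟨𝒰, h𝒰⟩ := h F hF hdeg p hp M hM
  exact ⟨𝒰, h𝒰 𝔮⟩

/-- **… and so does the whole conclusion of [SW, Prop. 4.1] for these models** ("every prime of
`R_𝒟` is pro-modular"), without (P2), connectivity or supply: the expectation short-circuits the
propagation. [cite: SkinnerWiles1999, §4.3 Prop. 4.1] -/
theorem forall_isProModularPrime_of_orientedFamiliesProModular (h : OrientedFamiliesProModular) :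
    ∀ (F : Type) [Field F] [NumberField F], IsTotallyComplex F → Module.finrank ℚ F = 2 →
      ∀ (p : ℕ) [Fact p.Prime], p ≠ 2 →
      ∀ M : ModelData F p, M.IsSWOriented p → ∀ 𝔮 : PrimeSpectrum M.𝓡.R, IsProModularPrime M.𝓡 𝔮 := by
  intro F _ _ hF hdeg p _ hp M hM 𝔮
  obtain ⟨𝒰, h𝒰⟩ := h F hF hdeg p hp M hM
  exact ⟨𝒰, h𝒰 𝔮⟩

end

end Summit.Langlands.Langlands.Cruxes.ReducibleOrdinaryProModular.FineSelmerCodimensionTwo
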